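import Summits.BirchSwinnertonDyer.BirchSwinnertonDyer.Theorems.Rank1ResidualJetThm63RowData
import Literature.NumberTheory.EllipticCurves.McCallum1991.EigenclassesCebotarevLevelPow
import HarnessLib

/-!
# Route `ErratumRoadFive`, crux `EulerHalfPOnlyMultPotMultTwinAtFive` (23444), line `genus`, stub S4♯, child (b),
# twin (b2b) `GenusJetchevThm63`: Jetchev's Thm. 6.3 at a core vertex over CLASS DATA — the tree's concrete
# assembly `JET.tamagawaExponent_le_mInfty_of_rowData` with the Kolyvagin classes ABSTRACT
# (seat `bsd-idea-9` g25, line owner, lens «programme completion»; helper `--supports 23444 --as helper`)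

THEOREMS ONLY (no definition, no named fact, no `sorry`). HONEST FRAMING: nothing here proves a
divisibility, a Tamagawa bound for a given curve, the twin (b2b), the child (b), S4♯, the crux 23444 or
any summit statement; BSD is proved for no curve. WHAT THIS IS. Road K (cell `bsd-jet`) assembles
[J] Thm. 5.2 (= arXiv Thm. 6.3) at a core vertex `c` on CONCRETE Selmer data in
`JET.tamagawaExponent_le_mInfty_of_rowData` (`Rank1ResidualJetThm63RowData.lean`, p492296 line): the abstract
kernel theorem `JET.Section6.tamagawaExponent_le_mInfty_of_minimalCoreVertex_rowForm` fed with
`H = H¹(K, E[p^k])`, `A′ = (H_{𝓕(c)})^{−ε}`, `B′ = (H_{𝓕₀(c)})^{−ε}`, `D′_λ`, `C′`, the two Poitou–Tate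
packages, Lemma 6.1 from [McC] Cor. 3.2, and — the ONLY place where the Heegner frame
(`SatisfiesHeegnerHypothesis`, `ModularParametrizationData`, `KolyvaginHeegnerData`, [McC] Prop. 4.4 as the
typed fact `h44`) enters — the classes `κ = c_k(c) := d.kolyvaginClass`, `κ_{cℓ} := (dℓ …).kolyvaginClass`
and Prop. 4.7 for them (step (6), from `h44`). The same file has been re-copied for four other families in
the tree (`PrintX9…RowData`, `PrintX10b…RowData`, `KatoDescent…RowData*`, `…ModPThm63RowData`), each time
with `KolyvaginHeegnerData` classes. This file states the assembly ONCE over CLASS DATA: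
* `tamagawaExponent_le_mInfty_of_classData` — `κ, κ_{cℓ} ∈ H¹(K, E[p^k])` are PARAMETERS with the
  printed properties as hypotheses (S7: `κ ∈ H_{𝓕(c)}`, `τκ = εκ`, `κ ≠ 0`, `ord κ = p^{k−m_∞}`;
  Prop. 4.9♯: `κ_{cℓ} ∈ (H_{(𝓕₀)^λ(c)})^{−ε}`; Prop. 4.7: `ord loc_λ κ_{cℓ} = ord loc_λ κ`); NO Heegner
  hypothesis, NO parametrisation, NO `KolyvaginHeegnerData`, NO typed McCallum fact: [McC] Cor. 3.2 is the
  tree's THEOREM `McCallum1991.cor32_eigenclasses_infinite_primes_localOrder_holds` (Čebotarev + Weil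
  pairing), used through road K's adapter `JET.exists_kolyvaginPrime_addOrderOf_localization_eq_of_cor32`;
  steps (1) sign selection (`JET.isGlobalCoreVertex_sign_of_ne_zero`), (2) `B′ ≤ A′`
  (`JET.SelmerVocabulary.selmerGroup_selmerF_eq_modifiedSelmerGroup`, `JET.signPart_mono`), (3)–(5), (7) are
  road K's, verbatim, BY NAME;
* `tamagawaExponent_le_mInfty_of_rowData_of_classData` — FAITHFULNESS: road K's concrete statement
  WITHOUT its `h32` binder (now a theorem), recovered from the class-data form with `κ := d.kolyvaginClass`
  and Prop. 4.7 from `h44` exactly as road K's step (6)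
(`JET.addOrderOf_localization_kolyvaginClass_mul_eq_of_prop44`).
WHY (line `genus`, v1.8 twin (b2b) `GenusJetchevThm63`, card
`Cruxes/EulerHalfNotRamNoInertSetAtFive/Lines/genus_turnkey_v18.md`):
the genus family's classes are NOT `KolyvaginHeegnerData.kolyvaginClass` (no Heegner hypothesis for `W`
over `K`; the points are `D_m(Θ_ϑ Q)` transported from the CM presentation `E′`), so (b2b)'s prover needs
Thm. 6.3 keyed by classes, not by Heegner data: (b2b) ⟸ this theorem BY NAME + the genus class bricks
{S7 at a minimal-depth core vertex, Prop. 4.7 (Euler relation up to the sign `χ(Frob_λ)`), Prop. 4.9♯}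
+ road K's frame-free duality packages (`JET.GlobalDuality.exists_rowDuality_modified`) + the depth → order
bookkeeping. References: [cite: Jetchev2008, Thm. 5.2 (p. 821) and its proof (pp. 821–822) = arXiv
Thm. 6.3; Prop. 4.7; Prop. 4.9] [cite: McCallumLMS1991, §3 Cor. 3.2, §4 Prop. 4.4].
-/

set_option autoImplicit false
set_option linter.dupNamespace false

noncomputable section

open scoped Classical

open WeierstrassCurve IsDedekindDomain NumberField Literature.NumberTheory.EllipticCurves
  Literature.NumberTheory.EllipticCurves.ModularForms Literature.NumberTheory.EllipticCurves.Jetchev2008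
  Literature.NumberTheory.GaloisRepresentations
  Literature.NumberTheory.GaloisRepresentations.DiscreteGaloisModule
  Summit.BirchSwinnertonDyer.Rank1Residual

namespace Summit.BirchSwinnertonDyer.BirchSwinnertonDyer.Theorems.GenusKolyvagin.ClassData

/-- **[J] Thm. 5.2 (arXiv Thm. 6.3) at a core vertex, over CLASS DATA** — road K's
`JET.tamagawaExponent_le_mInfty_of_rowData` with the classes `κ`, `κ_{cℓ}` abstract elements of
`H¹(K, E[p^k])`, Prop. 4.7 a hypothesis, and [McC] Cor. 3.2 discharged by the tree's theorem; no Heegner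
hypothesis, parametrisation or Kolyvagin–Heegner datum occurs. CONCLUSION: `t ≤ m_∞`.
[cite: Jetchev2008, Thm. 5.2 (p. 821) and its proof] [cite: McCallumLMS1991, §3 Cor. 3.2] -/
theorem tamagawaExponent_le_mInfty_of_classData
    (W : WeierstrassCurve ℚ) [W.IsElliptic] [W.IsGloballyMinimal] [NeZero (W.conductorNorm ℤ)]
    (hcm : ¬ W.HasCM) (K : Type) [Field K] [NumberField K] (hK : IsImaginaryQuadratic K)
    (p : ℕ) [Fact p.Prime] (hp2 : p ≠ 2) (htower : ∀ n : ℕ, W.HasSurjectiveModNGaloisRep (p ^ n : ℕ))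
    (ι : K →+* ℂ)
    [∀ j : ℕ, NumberField (ringClassField K ι j)]
    (τ : K ≃ₐ[ℚ] K) (hτ : τ ≠ 1)
    -- the level `p^k`, the exponents
    (k t mInf : ℕ) (hk : 1 ≤ k) (htk : t < k) (hik : mInf < k)
    -- the core vertex
    (c : ℕ) (hc : Squarefree c)
    (hcore : IsGlobalCoreVertex W K ι τ p k c)
    -- the class `κ` (ABSTRACT — any element of `H¹(K, E[p^k])`): sign, Selmer membership, non-vanishing, order
    (e : ℤ) (he : e = 1 ∨ e = -1) (κ : galH1Torsion (W.baseChange K) ((p ^ k : ℕ) : ℤ))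
    (hκsel : κ ∈ modifiedSelmerGroup W K ι ((p ^ k : ℕ) : ℤ) c)
    (hκsign : conjAct W τ ((p ^ k : ℕ) : ℤ) κ = e • κ)
    (hκ0 : κ ≠ 0)
    (hordκ : addOrderOf κ = p ^ (k - mInf))
    -- the structures: transverse family (reconciled with `transverseKer` on `c`), stringent family, carrier places
    (𝒯 𝒮 : SelmerStructure ((W.baseChange K).torsionGaloisModule ((p ^ k : ℕ) : ℤ)))
    (hT : ∀ x : galoisCohomology ((W.baseChange K).torsionGaloisModule ((p ^ k : ℕ) : ℤ)) 1,
      (∀ w ∈ placesDividing K c,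
        galoisCohomology.localization ((W.baseChange K).torsionGaloisModule ((p ^ k : ℕ) : ℤ))
          (Sum.inr w) 1 x ∈ 𝒯 (Sum.inr w)) ↔
      ∀ ℓ ∈ c.primeFactors, x ∈ transverseKer W K ι ((p ^ k : ℕ) : ℤ) ℓ)
    (hS : ∀ v, 𝒮 v ≤ (W.baseChange K).kummerSelmerStructure ((p ^ k : ℕ) : ℤ) v)
    (Qcar : Finset (HeightOneSpectrum (𝓞 K))) (hQcar : Disjoint Qcar (placesDividing K c))
    -- the dual module `C' = (H_{𝓕₀(c)^*})^{−ε}` (parameter) inside `H^{−ε}`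
    (C' : AddSubgroup (galH1Torsion (W.baseChange K) ((p ^ k : ℕ) : ℤ)))
    (hC : C' ≤ signPart W K τ ((p ^ k : ℕ) : ℤ) (-e) ⊤)
    -- Thm 5.1 at the carrier for `𝓕₀(c) ≼ 𝓕(c)` (−ε parts) and (δ): the local quotient is cyclic of order `p^t`
    (hdual_q : ∃ (Qg Qg' : Type) (_ : AddCommGroup Qg) (_ : AddCommGroup Qg') (_ : Finite Qg')
      (locq : signPart W K τ ((p ^ k : ℕ) : ℤ) (-e) (modifiedSelmerGroup W K ι ((p ^ k : ℕ) : ℤ) c) →+ Qg)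
      (locq' : C' →+ Qg'),
      (∀ x : C', locq' x = 0 ↔ (x : galH1Torsion (W.baseChange K) ((p ^ k : ℕ) : ℤ)) ∈
        signPart W K τ ((p ^ k : ℕ) : ℤ) (-e) (modifiedSelmerGroup W K ι ((p ^ k : ℕ) : ℤ) c)) ∧
      Nat.card locq.range * Nat.card locq'.range = Nat.card Qg' ∧ IsAddCyclic Qg' ∧ Nat.card Qg' = p ^ t)
    -- per Kolyvagin prime `ℓ ∤ c` of index `≥ k`: the class `κ_{cℓ}` (ABSTRACT), Prop 4.9♯ for it,
    -- Prop 4.7 (`ord loc_λ κ_{cℓ} = ord loc_λ κ`) as a HYPOTHESIS, duality at `λ`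
    (κℓ : ∀ ℓ : ℕ, Zhang2014.IsKolyvaginPrime (W.conductorNorm ℤ) W K p ℓ → k ≤ Zhang2014.kolyvaginIndex W p ℓ →
      ℓ ∉ c.primeFactors → galH1Torsion (W.baseChange K) ((p ^ k : ℕ) : ℤ))
    (h49 : ∀ (ℓ : ℕ) (h1 : Zhang2014.IsKolyvaginPrime (W.conductorNorm ℤ) W K p ℓ)
      (h2 : k ≤ Zhang2014.kolyvaginIndex W p ℓ) (h3 : ℓ ∉ c.primeFactors)
      (v : HeightOneSpectrum (𝓞 K)), (ℓ : 𝓞 K) ∈ v.asIdeal →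
      κℓ ℓ h1 h2 h3 ∈
        signPart W K τ ((p ^ k : ℕ) : ℤ) (-e)
          (((selmerF0 W ((p ^ k : ℕ) : ℤ) 𝒯 𝒮 (placesDividing K c) Qcar).relaxedAt {v}).selmerGroup))
    (h47 : ∀ (ℓ : ℕ) (h1 : Zhang2014.IsKolyvaginPrime (W.conductorNorm ℤ) W K p ℓ)
      (h2 : k ≤ Zhang2014.kolyvaginIndex W p ℓ) (h3 : ℓ ∉ c.primeFactors)
      (v : HeightOneSpectrum (𝓞 K)), (ℓ : 𝓞 K) ∈ v.asIdeal →
      addOrderOf (galoisCohomology.localization ((W.baseChange K).torsionGaloisModule ((p ^ k : ℕ) : ℤ))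
          (Sum.inr v) 1 (κℓ ℓ h1 h2 h3)) =
        addOrderOf (galoisCohomology.localization ((W.baseChange K).torsionGaloisModule ((p ^ k : ℕ) : ℤ))
          (Sum.inr v) 1 κ))
    (hdual_ℓ : ∀ (ℓ : ℕ), Zhang2014.IsKolyvaginPrime (W.conductorNorm ℤ) W K p ℓ →
      k ≤ Zhang2014.kolyvaginIndex W p ℓ → ℓ ∉ c.primeFactors →
      ∀ (v : HeightOneSpectrum (𝓞 K)), (ℓ : 𝓞 K) ∈ v.asIdeal →
      ∃ (Sg : Type) (_ : AddCommGroup Sg)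
        (sing : signPart W K τ ((p ^ k : ℕ) : ℤ) (-e)
          (((selmerF0 W ((p ^ k : ℕ) : ℤ) 𝒯 𝒮 (placesDividing K c) Qcar).relaxedAt {v}).selmerGroup) →+ Sg),
        (∀ x, sing x = 0 ↔ (x : galoisCohomology ((W.baseChange K).torsionGaloisModule ((p ^ k : ℕ) : ℤ)) 1) ∈
          signPart W K τ ((p ^ k : ℕ) : ℤ) (-e)
            ((selmerF0 W ((p ^ k : ℕ) : ℤ) 𝒯 𝒮 (placesDividing K c) Qcar).selmerGroup)) ∧
        Nat.card sing.range *
          Nat.card (C'.map (galoisCohomology.localization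
            ((W.baseChange K).torsionGaloisModule ((p ^ k : ℕ) : ℤ)) (Sum.inr v) 1 :
              galH1Torsion (W.baseChange K) ((p ^ k : ℕ) : ℤ) →+ _)) = p ^ k) :
    t ≤ mInf := by
  have hp : p.Prime := Fact.out
  have hc0 : c ≠ 0 := hc.ne_zero
  -- notation
  let H := galH1Torsion (W.baseChange K) ((p ^ k : ℕ) : ℤ)
  let ρ := (W.baseChange K).torsionGaloisModule ((p ^ k : ℕ) : ℤ)
  let A' : AddSubgroup H := signPart W K τ ((p ^ k : ℕ) : ℤ) (-e)
    (modifiedSelmerGroup W K ι ((p ^ k : ℕ) : ℤ) c)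
  let F0 := selmerF0 W ((p ^ k : ℕ) : ℤ) 𝒯 𝒮 (placesDividing K c) Qcar
  let B' : AddSubgroup H := signPart W K τ ((p ^ k : ℕ) : ℤ) (-e) F0.selmerGroup
  -- the index type of usable Kolyvagin primes and the place over each
  let I := {ℓ : ℕ // Zhang2014.IsKolyvaginPrime (W.conductorNorm ℤ) W K p ℓ ∧
    k ≤ Zhang2014.kolyvaginIndex W p ℓ ∧ ℓ ∉ c.primeFactors}
  have hvne : ∀ ℓ : I, Ideal.span {(ℓ.1 : 𝓞 K)} ≠ ⊥ := fun ℓ ↦ by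
    rw [Ne, Ideal.span_singleton_eq_bot]
    exact_mod_cast ℓ.2.1.1.ne_zero
  let v : I → HeightOneSpectrum (𝓞 K) := fun ℓ ↦ ⟨Ideal.span {(ℓ.1 : 𝓞 K)}, ℓ.2.1.2.2.2.2.1, hvne ℓ⟩
  have hv : ∀ ℓ : I, (ℓ.1 : 𝓞 K) ∈ (v ℓ).asIdeal := fun ℓ ↦ Ideal.mem_span_singleton_self _
  let loc : ∀ ℓ : I, H →+ galoisCohomology (ρ.toLocal (Sum.inr (v ℓ))) 1 :=
    fun ℓ ↦ galoisCohomology.localization ρ (Sum.inr (v ℓ)) 1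
  let D' : I → AddSubgroup H := fun ℓ ↦ signPart W K τ ((p ^ k : ℕ) : ℤ) (-e)
    ((F0.relaxedAt {v ℓ}).selmerGroup)
  -- (1) sign selection at the core vertex: `A' = ⊥`
  have hκA : κ ∈ signPart W K τ ((p ^ k : ℕ) : ℤ) e (modifiedSelmerGroup W K ι ((p ^ k : ℕ) : ℤ) c) :=
    (mem_signPart_iff W K τ _ e _ κ).mpr ⟨hκsel, hκsign⟩
  have hcore' : A' = ⊥ := (JET.isGlobalCoreVertex_sign_of_ne_zero W K ι τ p k c hcore he hκA hκ0).2.2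
  -- (2) `B' ≤ A'`: `H_{𝓕₀(c)} ≤ H_{𝓕(c)} = modifiedSelmerGroup`
  have hF0le : F0.selmerGroup ≤ (selmerF W ((p ^ k : ℕ) : ℤ) 𝒯 (placesDividing K c)).selmerGroup := by
    intro x hx
    rw [SelmerStructure.mem_selmerGroup_iff] at hx ⊢
    intro w
    rcases w with w | w
    · simpa [F0, JET.SelmerVocabulary.selmerF0_inl] using hx (Sum.inl w)
    · have hxw := hx (Sum.inr w)
      by_cases hwQ : w ∈ Qcar
      · have hwS : w ∉ placesDividing K c := fun h ↦ (Finset.disjoint_left.mp hQcar) hwQ h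
        simp only [F0, JET.SelmerVocabulary.selmerF0_inr, hwQ, if_true] at hxw
        rw [JET.SelmerVocabulary.selmerF_inr, if_neg hwS]
        exact hS _ hxw
      · simpa [F0, JET.SelmerVocabulary.selmerF0_inr, hwQ] using hxw
  have hFeq : (selmerF W ((p ^ k : ℕ) : ℤ) 𝒯 (placesDividing K c)).selmerGroup =
      modifiedSelmerGroup W K ι ((p ^ k : ℕ) : ℤ) c :=
    JET.SelmerVocabulary.selmerGroup_selmerF_eq_modifiedSelmerGroup W ι ((p ^ k : ℕ) : ℤ) 𝒯 hc0 hT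
  have hB'A' : B' ≤ A' := JET.signPart_mono W K τ _ _ (hFeq ▸ hF0le)
  -- (3) the duality packages
  obtain ⟨Qg, Qg', instQ, instQ', instF, locq, locq', hker, horth_q, hcyc, hcard⟩ := hdual_q
  have hdl := fun ℓ : I ↦ hdual_ℓ ℓ.1 ℓ.2.1 ℓ.2.2.1 ℓ.2.2.2 (v ℓ) (hv ℓ)
  choose Sg instS sing hsing horth_ℓ using hdl
  -- (4) the classes `κ_{cℓ}`
  let κℓ' : I → H := fun ℓ ↦ κℓ ℓ.1 ℓ.2.1 ℓ.2.2.1 ℓ.2.2.2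
  have h49' : ∀ ℓ : I, κℓ' ℓ ∈ D' ℓ := fun ℓ ↦ h49 ℓ.1 ℓ.2.1 ℓ.2.2.1 ℓ.2.2.2 (v ℓ) (hv ℓ)
  -- (5) Lemma 6.1 from McCallum Cor 3.2
  have h61 : ∀ y : H, y ∈ C' → y ≠ 0 →
      ∃ ℓ : I, addOrderOf (loc ℓ κ) = addOrderOf κ ∧ addOrderOf (loc ℓ y) = addOrderOf y := by
    intro y hyC hy0
    have hysign : conjAct W τ ((p ^ k : ℕ) : ℤ) y = (-e) • y :=
      ((mem_signPart_iff W K τ _ (-e) ⊤ y).mp (hC hyC)).2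
    obtain ⟨ℓ, hℓS, hKol, hidx, hord⟩ :=
      JET.exists_kolyvaginPrime_addOrderOf_localization_eq_of_cor32
        McCallum1991.cor32_eigenclasses_infinite_primes_localOrder_holds (W.conductorNorm ℤ) W hcm K hK p
        hp2 htower τ hτ k hk he κ y hκsign hysign hy0 c.primeFactors
    exact ⟨⟨ℓ, hKol, hidx, hℓS⟩, hord (v ⟨ℓ, hKol, hidx, hℓS⟩) (hv ⟨ℓ, hKol, hidx, hℓS⟩)⟩
  -- (6) Prop 4.7 is a hypothesis here
  have h47' : ∀ ℓ : I, addOrderOf (loc ℓ (κℓ' ℓ)) = addOrderOf (loc ℓ κ) := fun ℓ ↦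
    h47 ℓ.1 ℓ.2.1 ℓ.2.2.1 ℓ.2.2.2 (v ℓ) (hv ℓ)
  -- (7) assemble
  exact JET.Section6.tamagawaExponent_le_mInfty_of_minimalCoreVertex_rowForm hp htk.le hik.le
    loc loc A' B' C' D' hB'A' hcore' locq locq' hker horth_q hcyc hcard κ hordκ h61
    sing hsing horth_ℓ κℓ' h49' h47'

/-- **Faithfulness**: road K's concrete `JET.tamagawaExponent_le_mInfty_of_rowData` — minus its `h32`
binder, which is the tree's theorem `McCallum1991.cor32_eigenclasses_infinite_primes_localOrder_holds` —
recovered from `tamagawaExponent_le_mInfty_of_classData` with `κ := c_k(c)`, `κ_{cℓ} := c_k(cℓ)` and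
Prop. 4.7 from [McC] Prop. 4.4 (`h44`) as in road K's step (6). (The class-data form loses nothing.)
[cite: Jetchev2008, Thm. 5.2 (p. 821)] [cite: McCallumLMS1991, §4 Prop. 4.4] -/
theorem tamagawaExponent_le_mInfty_of_rowData_of_classData
    (h44 : McCallum1991.prop44_localOrder_kolyvaginClass_mul_eq)
    (W : WeierstrassCurve ℚ) [W.IsElliptic] [W.IsGloballyMinimal] [NeZero (W.conductorNorm ℤ)]
    (hcm : ¬ W.HasCM) (K : Type) [Field K] [NumberField K] (hK : IsImaginaryQuadratic K)
    (hD3 : NumberField.discr K ≠ -3) (hD4 : NumberField.discr K ≠ -4)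
    (hH : SatisfiesHeegnerHypothesis (W.conductorNorm ℤ) K)
    (p : ℕ) [Fact p.Prime] (hp2 : p ≠ 2) (htower : ∀ n : ℕ, W.HasSurjectiveModNGaloisRep (p ^ n : ℕ))
    (Dt : ModularParametrizationData W (W.conductorNorm ℤ)) (β : ℤ) (ι : K →+* ℂ)
    [∀ j : ℕ, NumberField (ringClassField K ι j)]
    (τ : K ≃ₐ[ℚ] K) (hτ : τ ≠ 1)
    -- the level `p^k`, the exponents
    (k t mInf : ℕ) (hk : 1 ≤ k) (htk : t < k) (hik : mInf < k)
    -- the core vertex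
    (c : ℕ) (hc : Squarefree c)
    (hcK : ∀ ℓ ∈ c.primeFactors, Zhang2014.IsKolyvaginPrime (W.conductorNorm ℤ) W K p ℓ ∧
      k ≤ Zhang2014.kolyvaginIndex W p ℓ)
    (hcore : IsGlobalCoreVertex W K ι τ p k c)
    -- the class `κ = c_k(c)`: sign, Selmer membership, non-vanishing, order (S7)
    (e : ℤ) (he : e = 1 ∨ e = -1) (d : KolyvaginHeegnerData Dt β ι c)
    (hκsel : d.kolyvaginClass (Fact.out : p.Prime) k ∈
      modifiedSelmerGroup W K ι ((p ^ k : ℕ) : ℤ) c)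
    (hκsign : conjAct W τ ((p ^ k : ℕ) : ℤ) (d.kolyvaginClass (Fact.out : p.Prime) k) =
      e • d.kolyvaginClass (Fact.out : p.Prime) k)
    (hκ0 : d.kolyvaginClass (Fact.out : p.Prime) k ≠ 0)
    (hordκ : addOrderOf (d.kolyvaginClass (Fact.out : p.Prime) k) = p ^ (k - mInf))
    -- the structures: transverse family (reconciled with `transverseKer` on `c`), stringent family, carrier places
    (𝒯 𝒮 : SelmerStructure ((W.baseChange K).torsionGaloisModule ((p ^ k : ℕ) : ℤ)))
    (hT : ∀ x : galoisCohomology ((W.baseChange K).torsionGaloisModule ((p ^ k : ℕ) : ℤ)) 1,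
      (∀ w ∈ placesDividing K c,
        galoisCohomology.localization ((W.baseChange K).torsionGaloisModule ((p ^ k : ℕ) : ℤ))
          (Sum.inr w) 1 x ∈ 𝒯 (Sum.inr w)) ↔
      ∀ ℓ ∈ c.primeFactors, x ∈ transverseKer W K ι ((p ^ k : ℕ) : ℤ) ℓ)
    (hS : ∀ v, 𝒮 v ≤ (W.baseChange K).kummerSelmerStructure ((p ^ k : ℕ) : ℤ) v)
    (Qcar : Finset (HeightOneSpectrum (𝓞 K))) (hQcar : Disjoint Qcar (placesDividing K c))
    -- the dual module `C' = (H_{𝓕₀(c)^*})^{−ε}` (parameter) inside `H^{−ε}`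
    (C' : AddSubgroup (galH1Torsion (W.baseChange K) ((p ^ k : ℕ) : ℤ)))
    (hC : C' ≤ signPart W K τ ((p ^ k : ℕ) : ℤ) (-e) ⊤)
    -- Thm 5.1 at the carrier for `𝓕₀(c) ≼ 𝓕(c)` (−ε parts) and (δ): the local quotient is cyclic of order `p^t`
    (hdual_q : ∃ (Qg Qg' : Type) (_ : AddCommGroup Qg) (_ : AddCommGroup Qg') (_ : Finite Qg')
      (locq : signPart W K τ ((p ^ k : ℕ) : ℤ) (-e) (modifiedSelmerGroup W K ι ((p ^ k : ℕ) : ℤ) c) →+ Qg)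
      (locq' : C' →+ Qg'),
      (∀ x : C', locq' x = 0 ↔ (x : galH1Torsion (W.baseChange K) ((p ^ k : ℕ) : ℤ)) ∈
        signPart W K τ ((p ^ k : ℕ) : ℤ) (-e) (modifiedSelmerGroup W K ι ((p ^ k : ℕ) : ℤ) c)) ∧
      Nat.card locq.range * Nat.card locq'.range = Nat.card Qg' ∧ IsAddCyclic Qg' ∧ Nat.card Qg' = p ^ t)
    -- per Kolyvagin prime `ℓ ∤ c` of index `≥ k`: compatible data on `cℓ`, Prop 4.9 for `cℓ`, duality at `λ`
    (dℓ : ∀ ℓ : ℕ, Zhang2014.IsKolyvaginPrime (W.conductorNorm ℤ) W K p ℓ → k ≤ Zhang2014.kolyvaginIndex W p ℓ →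
      ℓ ∉ c.primeFactors → KolyvaginHeegnerData Dt β ι (c * ℓ))
    (hdata : ∀ (ℓ : ℕ) (h1 : Zhang2014.IsKolyvaginPrime (W.conductorNorm ℤ) W K p ℓ)
      (h2 : k ≤ Zhang2014.kolyvaginIndex W p ℓ) (h3 : ℓ ∉ c.primeFactors),
      (∀ l' ∈ c.primeFactors, ∀ (x : ringClassField K ι c) (x' : ringClassField K ι (c * ℓ)),
        (x : ℂ) = x' → (((dℓ ℓ h1 h2 h3).σ l' x' : ringClassField K ι (c * ℓ)) : ℂ) = (d.σ l' x : ℂ)) ∧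
      (∀ s ∈ d.S, ∃ s' ∈ (dℓ ℓ h1 h2 h3).S, ∀ (x : ringClassField K ι c) (x' : ringClassField K ι (c * ℓ)),
        (x : ℂ) = x' → ((s' x' : ringClassField K ι (c * ℓ)) : ℂ) = (s x : ℂ)) ∧
      (∀ s' ∈ (dℓ ℓ h1 h2 h3).S, ∃ s ∈ d.S, ∀ (x : ringClassField K ι c) (x' : ringClassField K ι (c * ℓ)),
        (x : ℂ) = x' → ((s' x' : ringClassField K ι (c * ℓ)) : ℂ) = (s x : ℂ)) ∧
      (∀ (x : ringClassField K ι c) (x' : ringClassField K ι (c * ℓ)),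
        (x : ℂ) = x' → (dℓ ℓ h1 h2 h3).emb x' = d.emb x))
    (h49 : ∀ (ℓ : ℕ) (h1 : Zhang2014.IsKolyvaginPrime (W.conductorNorm ℤ) W K p ℓ)
      (h2 : k ≤ Zhang2014.kolyvaginIndex W p ℓ) (h3 : ℓ ∉ c.primeFactors)
      (v : HeightOneSpectrum (𝓞 K)), (ℓ : 𝓞 K) ∈ v.asIdeal →
      (dℓ ℓ h1 h2 h3).kolyvaginClass (Fact.out : p.Prime) k ∈
        signPart W K τ ((p ^ k : ℕ) : ℤ) (-e)
          (((selmerF0 W ((p ^ k : ℕ) : ℤ) 𝒯 𝒮 (placesDividing K c) Qcar).relaxedAt {v}).selmerGroup))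
    (hdual_ℓ : ∀ (ℓ : ℕ), Zhang2014.IsKolyvaginPrime (W.conductorNorm ℤ) W K p ℓ →
      k ≤ Zhang2014.kolyvaginIndex W p ℓ → ℓ ∉ c.primeFactors →
      ∀ (v : HeightOneSpectrum (𝓞 K)), (ℓ : 𝓞 K) ∈ v.asIdeal →
      ∃ (Sg : Type) (_ : AddCommGroup Sg)
        (sing : signPart W K τ ((p ^ k : ℕ) : ℤ) (-e)
          (((selmerF0 W ((p ^ k : ℕ) : ℤ) 𝒯 𝒮 (placesDividing K c) Qcar).relaxedAt {v}).selmerGroup) →+ Sg),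
        (∀ x, sing x = 0 ↔ (x : galoisCohomology ((W.baseChange K).torsionGaloisModule ((p ^ k : ℕ) : ℤ)) 1) ∈
          signPart W K τ ((p ^ k : ℕ) : ℤ) (-e)
            ((selmerF0 W ((p ^ k : ℕ) : ℤ) 𝒯 𝒮 (placesDividing K c) Qcar).selmerGroup)) ∧
        Nat.card sing.range *
          Nat.card (C'.map (galoisCohomology.localization
            ((W.baseChange K).torsionGaloisModule ((p ^ k : ℕ) : ℤ)) (Sum.inr v) 1 :
              galH1Torsion (W.baseChange K) ((p ^ k : ℕ) : ℤ) →+ _)) = p ^ k) :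
    t ≤ mInf := by
  have hp : p.Prime := Fact.out
  have hc0 : c ≠ 0 := hc.ne_zero
  refine tamagawaExponent_le_mInfty_of_classData W hcm K hK p hp2 htower ι τ hτ k t mInf hk htk hik c hc hcore
    e he (d.kolyvaginClass hp k) hκsel hκsign hκ0 hordκ 𝒯 𝒮 hT hS Qcar hQcar C' hC hdual_q
    (fun ℓ h1 h2 h3 ↦ (dℓ ℓ h1 h2 h3).kolyvaginClass hp k) h49 (fun ℓ h1 h2 h3 v hv ↦ ?_) hdual_ℓ
  -- Prop 4.7 from McCallum Prop 4.4 (verbatim the tree's step (6) of `JET.tamagawaExponent_le_mInfty_of_rowData`)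
  have hl : ℓ.Prime := h1.1
  have hlc : ¬ ℓ ∣ c := fun h ↦ h3 (Nat.mem_primeFactors.mpr ⟨hl, h, hc0⟩)
  have hsq : Squarefree (c * ℓ) :=
    (Nat.squarefree_mul ((Nat.Prime.coprime_iff_not_dvd hl).mpr hlc).symm).mpr ⟨hc, hl.squarefree⟩
  have hK' : ∀ l' ∈ (c * ℓ).primeFactors,
      Zhang2014.IsKolyvaginPrime (W.conductorNorm ℤ) W K p l' ∧ k ≤ Zhang2014.kolyvaginIndex W p l' := by
    intro l' hl'
    rw [Nat.primeFactors_mul hc0 hl.ne_zero, Finset.mem_union, hl.primeFactors,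
      Finset.mem_singleton] at hl'
    rcases hl' with h | rfl
    · exact hcK l' h
    · exact ⟨h1, h2⟩
  obtain ⟨hσ, hSS, hSS', hemb⟩ := hdata ℓ h1 h2 h3
  exact JET.addOrderOf_localization_kolyvaginClass_mul_eq_of_prop44 h44 W hcm K hK hD3 hD4 hH p hp2 htower
    Dt β ι k hk c ℓ hsq hl hlc hK' d _ hσ hSS hSS' hemb v hv

end Summit.BirchSwinnertonDyer.BirchSwinnertonDyer.Theorems.GenusKolyvagin.ClassData

end
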